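import Mathlib
import Summits.Ventures.PercRepro2.Defs
import Summits.Ventures.PercRepro2.Graph
import Summits.Ventures.PercRepro2.OneColourSwitch
import Summits.Ventures.PercRepro2.RegionHubSign
import Summits.Ventures.PercRepro2.SideSwitch
import Summits.Ventures.PercRepro2.TermSwitchDefs
import Summits.Ventures.PercRepro2.TermSwitchReach
import Summits.Ventures.PercRepro2.M9NoPocketDefs
import Summits.Ventures.PercRepro2.M9GeneralDSplit
import Summits.Ventures.PercRepro2.M9ReachedSum
import Summits.Ventures.PercRepro2.M9FourParts
import Summits.Ventures.PercRepro2.M9OneSidedFibre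
import Summits.Ventures.PercRepro2.M9OneSidedTEdge
import Summits.Ventures.PercRepro2.M9OneSidedTEdgeLz

/-!
# The `r ↔ s` symmetry of the single-`d` sums, and ⟦Lz⟧ for every `d` adjacent to at most one of
`r, s` (blind cell PercRepro2, p3 g30, 2026-08-28; `proofs/P3-HDR.md` §13)

Every quantity of the single-`d` statement is symmetric in the two marks `r, s` (`sigma` through
`conn_symm`, the worlds `K₂ / M₂` through `Set.pair_comm`, the triple `{r, s, d}` through
`Set.insert_comm`).  Hence `cleanReachedSum_nonpos_of_tedge` (no `d–s` edge) also covers the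
class with no `d–r` edge: **⟦Lz⟧ holds whenever there is no `r–s` edge and `d` is adjacent to at
most one of `r, s`** (`cleanReachedSum_nonpos_of_one_free`), and in that class **the single-`d`
statement follows from `EX + HD ≤ 0` alone** (`dSignSum_nonpos_of_exhd_one_free`).  Own work;
std axioms.
-/

namespace Summit.Ventures.PercRepro2

namespace NoPocket

open Finset Classical RegionHub OneColourSwitch SideSwitch TermSwitch

variable {V : Type*} {E : Type*}

section SymmRS

variable [Fintype V] [DecidableEq V] [Fintype E] [DecidableEq E] {ends : E → Sym2 V}
  {p q r s d : V}

omit [Fintype V] [DecidableEq V] [Fintype E] [DecidableEq E] in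
/-- `σ` is symmetric. -/
lemma sigma_swap (ω : Config E) (a b : V) : sigma ends ω a b = sigma ends ω b a := by
  unfold sigma
  have h1 : Conn ends ω a b ↔ Conn ends ω b a := ⟨conn_symm, conn_symm⟩
  have h2 : Conn ends (OneColourSwitch.compl ω) a b ↔ Conn ends (OneColourSwitch.compl ω) b a :=
    ⟨conn_symm, conn_symm⟩
  simp only [h1, h2]

omit [Fintype V] [DecidableEq V] [Fintype E] [DecidableEq E] in
/-- `sep2` is symmetric in `r, s`. -/
lemma sep2_swap (ω : Config E) : sep2 ends p q r s ω ↔ sep2 ends p q s r ω := by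
  unfold sep2 sepY
  constructor
  · rintro ⟨⟨h1, h2, h3, h4⟩, ⟨h5, h6, h7, h8⟩⟩
    exact ⟨⟨h2, h1, h4, h3⟩, ⟨h6, h5, h8, h7⟩⟩
  · rintro ⟨⟨h1, h2, h3, h4⟩, ⟨h5, h6, h7, h8⟩⟩
    exact ⟨⟨h2, h1, h4, h3⟩, ⟨h6, h5, h8, h7⟩⟩

omit [Fintype V] [DecidableEq V] [Fintype E] [DecidableEq E] in
/-- The `Y`-world of `{r, s}` is symmetric in `r, s`. -/
lemma K2_swap (ω : Config E) : K2 ends r s ω = K2 ends s r ω := by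
  unfold K2; rw [Set.pair_comm]

omit [Fintype V] [DecidableEq V] [Fintype E] [DecidableEq E] in
/-- The `W`-world of `{r, s}` is symmetric in `r, s`. -/
lemma M2_swap (ω : Config E) : M2 ends r s ω = M2 ends s r ω := by
  unfold M2; rw [Set.pair_comm]

omit [Fintype V] [DecidableEq V] [Fintype E] [DecidableEq E] in
/-- `DOne` is symmetric in `r, s`. -/
lemma DOne_swap (ω : Config E) : DOne ends r s d ω ↔ DOne ends s r d ω := by
  unfold DOne
  rw [K2_swap, M2_swap]
  constructor
  · intro h x h1 h2 h3; exact h x h2 h1 h3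
  · intro h x h1 h2 h3; exact h x h2 h1 h3

omit [Fintype V] [DecidableEq V] [Fintype E] [DecidableEq E] in
/-- `Reached` is symmetric in `r, s`. -/
lemma Reached_swap (ω : Config E) : Reached ends r s d ω ↔ Reached ends s r d ω := by
  unfold Reached; rw [K2_swap, M2_swap]

omit [Fintype V] [DecidableEq V] [Fintype E] [DecidableEq E] in
/-- `OneSided` is symmetric in `r, s`. -/
lemma OneSided_swap (ω : Config E) : OneSided ends r s d ω ↔ OneSided ends s r d ω := by
  unfold OneSided; rw [K2_swap, M2_swap]

omit [Fintype V] [DecidableEq V] [Fintype E] [DecidableEq E] in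
/-- The triple `{r, s, d}` is symmetric in `r, s`. -/
lemma triple_swap : ({r, s, d} : Set V) = {s, r, d} := Set.insert_comm r s {d}

omit [Fintype V] [DecidableEq V] [Fintype E] [DecidableEq E] in
/-- `HD` is symmetric in `r, s`. -/
lemma HD_swap (ω : Config E) : HD ends p q r s d ω ↔ HD ends p q s r d ω := by
  unfold HD; rw [sep2_swap, DOne_swap, Reached_swap, triple_swap]

omit [Fintype V] [DecidableEq V] in
/-- The single-`d` sum is symmetric in `r, s`. -/
lemma dSignSum_swap : dSignSum ends p q r s d = dSignSum ends p q s r d := by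
  unfold dSignSum
  refine Finset.sum_congr rfl fun ω _ => ?_
  rw [sigma_swap ω r s]
  simp only [sep2_swap ω, DOne_swap ω]

omit [Fintype V] [DecidableEq V] in
/-- The hub–dead-end sum is symmetric in `r, s`. -/
lemma hdSum_swap : hdSum ends p q r s d = hdSum ends p q s r d := by
  unfold hdSum
  refine Finset.sum_congr rfl fun ω _ => ?_
  rw [sigma_swap ω r s]
  simp only [HD_swap ω]

omit [Fintype V] [DecidableEq V] in
/-- The doubly-reached sum is symmetric in `r, s`. -/
lemma exSum_swap : exSum ends p q r s d = exSum ends p q s r d := by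
  unfold exSum
  refine Finset.sum_congr rfl fun ω _ => ?_
  rw [sigma_swap ω r s, K2_swap, M2_swap]
  simp only [sep2_swap ω, DOne_swap ω]

omit [Fintype V] [DecidableEq V] in
/-- The unreached sum is symmetric in `r, s`. -/
lemma unreachedSum_swap : unreachedSum ends p q r s d = unreachedSum ends p q s r d := by
  unfold unreachedSum
  refine Finset.sum_congr rfl fun ω _ => ?_
  rw [sigma_swap ω r s, K2_swap, M2_swap]
  simp only [sep2_swap ω, DOne_swap ω]

omit [Fintype V] [DecidableEq V] in
/-- The clean one-sided reached sum is symmetric in `r, s`. -/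
lemma cleanReachedSum_swap : cleanReachedSum ends p q r s d = cleanReachedSum ends p q s r d := by
  unfold cleanReachedSum
  refine Finset.sum_congr rfl fun ω _ => ?_
  rw [sigma_swap ω r s, triple_swap]
  simp only [sep2_swap ω, DOne_swap ω, OneSided_swap ω]

omit [Fintype V] [DecidableEq V] [Fintype E] [DecidableEq E] in
/-- `TEdge` with the marks swapped: no `r–s` edge, no `d–r` edge. -/
lemma tEdge_swap (hrs : r ≠ s) (hrd : r ≠ d) (hsd : s ≠ d) (no_rs : ∀ e, ends e ≠ s(r, s))
    (no_dr : ∀ e, ends e ≠ s(d, r)) : TEdge ends s r d :=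
  ⟨hrs.symm, hsd, hrd, fun e h => no_rs e (by rw [h, Sym2.eq_swap]), no_dr⟩

/-- **⟦Lz⟧ with a `T`-edge `d–s`**: the clean one-sided reached part is non-positive whenever
there is no `r–s` edge and no `d–r` edge. -/
theorem cleanReachedSum_nonpos_of_tedge_swap (hT : TEdge ends s r d) :
    cleanReachedSum ends p q r s d ≤ 0 := by
  rw [cleanReachedSum_swap]
  exact cleanReachedSum_nonpos_of_tedge hT

/-- **THEOREM ⟦Lz⟧ for every `d` adjacent to at most one of `r, s`** (no `r–s` edge): the clean
one-sided reached part of the single-`d` sum is non-positive. -/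
theorem cleanReachedSum_nonpos_of_one_free (hrs : r ≠ s) (hrd : r ≠ d) (hsd : s ≠ d)
    (no_rs : ∀ e, ends e ≠ s(r, s))
    (h : (∀ e, ends e ≠ s(d, s)) ∨ (∀ e, ends e ≠ s(d, r))) :
    cleanReachedSum ends p q r s d ≤ 0 := by
  rcases h with h | h
  · exact cleanReachedSum_nonpos_of_tedge ⟨hrs, hrd, hsd, no_rs, h⟩
  · exact cleanReachedSum_nonpos_of_tedge_swap (tEdge_swap hrs hrd hsd no_rs h)

/-- **The single-`d` statement from `EX + HD ≤ 0` alone, for every `d` adjacent to at most one of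
`r, s`** (no `r–s` edge). -/
theorem dSignSum_nonpos_of_exhd_one_free (hrs : r ≠ s) (hrd : r ≠ d) (hsd : s ≠ d)
    (no_rs : ∀ e, ends e ≠ s(r, s))
    (h : (∀ e, ends e ≠ s(d, s)) ∨ (∀ e, ends e ≠ s(d, r)))
    (hexhd : exSum ends p q r s d + hdSum ends p q r s d ≤ 0) :
    dSignSum ends p q r s d ≤ 0 :=
  dSignSum_nonpos_of_exhd_lz hexhd (cleanReachedSum_nonpos_of_one_free hrs hrd hsd no_rs h)

end SymmRS

end NoPocket

end Summit.Ventures.PercRepro2
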